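import Mathlib
import HarnessLib
import Literature.MathematicalPhysics.QuantumLattice.SectorisedKernelNormRefinementPlateau
import Literature.MathematicalPhysics.QuantumLattice.GrassmannKernelExpansion
import Literature.MathematicalPhysics.QuantumLattice.GrassmannEffectiveActionRepresentation

/-!
# Route `KLProgramme` — crux K3, the nested two-volume pass: THE SECTOR PREIMAGE IS A MATRIX SUBSTITUTION (`Pre_F = map (ε • E_F)`), and composes with synthesis
# (cell gate-hubbard-kl, seat hubbard-kl-k3c4-p1 g9; blueprint VL-INDUCTION-BLUEPRINT-g9.md §B; `--supports` stmt-…-20440)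

The inductive two-volume comparison (`…TwoVolumeScaleSucc`) moves from scale `j` to `j+1` by a LINEAR SUBSTITUTION `map (toLin' T_j)` of the sector-field actions.  In the
tree the scale-`j+1` input is `sectorPreimage β F_{j+1} 𝒱^{(j)}` (`SectorisedEffectiveActionBound`), presented degree by degree from the sectorised kernels.  This file
identifies it as a matrix substitution, so that the transfer theorem p550784 and the weighted pushforward p556216 apply verbatim:

* **`sectorPreimage_eq_map_smul_sectorAnalysis`** — `sectorPreimage β F G = map (toLin' (ε • sectorAnalysisMatrix β F)) G`, `ε = imagTimeWeight β M` (both sides have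
  the kernels `ε^m · sectorisedKernel β F G m` in every degree: `kernel_sectorPreimage_eq_sectorisedKernel`, `kernel_map_sectorAnalysis`, `kernel_map`);
* **`sectorPreimage_map_eq_map_mul`** — `sectorPreimage β F′ (map (toLin' S) W) = map (toLin' ((ε • sectorAnalysisMatrix β F′) * S)) W` for ANY matrix `S` into the
  momentum fields (in the tower: `S = sectorSubMatrix β F̃_j`, so `T_j = ε • E(F_{j+1}) · S(F̃_j)`, the overlap kernel of `…TwoVolumeSectorOverlapPeriodisation`).

Model-generic (any volume, cutoff, family); everything proved; no definition.  Reference: BGM 2006 §2.7 (2.70)–(2.71).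
-/

noncomputable section

namespace Summit.HubbardSuperconductivity.HubbardSuperconductivity.Theorems.TwoVolumeDefect

set_option linter.dupNamespace false -- summit = problem name (single-conjunct summit), D-0017

open Finset Literature.MathematicalPhysics.QuantumLattice GrassmannAlgebra Literature.Probability.LatticeModels

variable {L M : ℕ} [NeZero L] {N : ℕ}

/-- **Kernels of the scaled analysis map**: `kernel (map (toLin' (c • E_F)) G) m Y = c^m · sectorisedKernel β F G m (ℓ∘Y) (x∘Y)`. [folklore] -/
theorem kernel_map_smul_sectorAnalysis (c : ℂ) (β : ℝ) (F : Fin N → FreqMomentum L M → ℂ) (G : HubbardGrassmann L M) (m : ℕ)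
    (Y : Fin m → SpaceTimeIdx L M × SectorLeg N) :
    kernel ℂ (ExteriorAlgebra.map (Matrix.toLin' (c • sectorAnalysisMatrix L M β F)) G) m Y =
      c ^ m * sectorisedKernel L M β F G m (fun i => (Y i).2) (fun i => (Y i).1) := by
  rw [← kernel_map_sectorAnalysis, kernel_map, kernel_map]
  simp only [LinearMap.toMatrix'_toLin', Matrix.smul_apply, smul_eq_mul]
  rw [mul_sum]
  refine sum_congr rfl fun X _ => ?_
  rw [prod_mul_distrib, prod_const, card_univ, Fintype.card_fin]
  ring

/-- **THE SECTOR PREIMAGE IS A MATRIX SUBSTITUTION**: `sectorPreimage β F G = map (toLin' (ε • sectorAnalysisMatrix β F)) G` with `ε = imagTimeWeight β M`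
(the analysis map scaled by the Riemann weight of one vertex).  [cite: BenfattoGiulianiMastropietro2006, §2.7 (2.70)] -/
theorem sectorPreimage_eq_map_smul_sectorAnalysis (β : ℝ) (F : Fin N → FreqMomentum L M → ℂ) (G : HubbardGrassmann L M) :
    sectorPreimage β F G =
      ExteriorAlgebra.map (Matrix.toLin' ((((imagTimeWeight β M : ℝ) : ℂ)) • sectorAnalysisMatrix L M β F)) G := by
  have hk : ∀ (m : ℕ) (Y : Fin m → SpaceTimeIdx L M × SectorLeg N), kernel ℂ (sectorPreimage β F G) m Y =
      kernel ℂ (ExteriorAlgebra.map (Matrix.toLin' ((((imagTimeWeight β M : ℝ) : ℂ)) • sectorAnalysisMatrix L M β F)) G) m Y := by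
    intro m Y
    rw [kernel_sectorPreimage_eq_sectorisedKernel, kernel_map_smul_sectorAnalysis]
  calc sectorPreimage β F G = ∑ m ∈ range (Fintype.card (SpaceTimeIdx L M × SectorLeg N) + 1), presented ℂ (kernel ℂ (sectorPreimage β F G) m) :=
        eq_sum_presented_kernel ℂ _
    _ = ∑ m ∈ range (Fintype.card (SpaceTimeIdx L M × SectorLeg N) + 1),
          presented ℂ (kernel ℂ (ExteriorAlgebra.map (Matrix.toLin' ((((imagTimeWeight β M : ℝ) : ℂ)) • sectorAnalysisMatrix L M β F)) G) m) := by
        refine sum_congr rfl fun m _ => ?_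
        congr 1
        funext Y
        exact hk m Y
    _ = _ := (eq_sum_presented_kernel ℂ _).symm

/-- **Composition with a synthesis**: for every matrix `S` into the momentum fields,
`sectorPreimage β F′ (map (toLin' S) W) = map (toLin' ((ε • sectorAnalysisMatrix β F′) * S)) W` — the re-sectorisation of the tower is ONE substitution with matrix
`ε • E(F′)·S`. [cite: BenfattoGiulianiMastropietro2006, §2.7 (2.71)] -/
theorem sectorPreimage_map_eq_map_mul {Γ : Type*} [Fintype Γ] [DecidableEq Γ] {N' : ℕ} (β : ℝ) (F' : Fin N' → FreqMomentum L M → ℂ)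
    (S : Matrix (HubbardFieldIdx L M) Γ ℂ) (W : GrassmannAlgebra ℂ Γ) :
    sectorPreimage β F' (ExteriorAlgebra.map (Matrix.toLin' S) W) =
      ExteriorAlgebra.map (Matrix.toLin' (((((imagTimeWeight β M : ℝ) : ℂ)) • sectorAnalysisMatrix L M β F') * S)) W := by
  rw [sectorPreimage_eq_map_smul_sectorAnalysis, map_map_eq_map_comp, Matrix.toLin'_mul]

end Summit.HubbardSuperconductivity.HubbardSuperconductivity.Theorems.TwoVolumeDefect

end
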